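import Summits.ResolutionOfSingularities.ResolutionOfSingularities.Theorems.WeightedInvariantP3aTieFreeDegenerate
import Summits.ResolutionOfSingularities.ResolutionOfSingularities.Theorems.WeightedInvariantP3aFaceForm
import Summits.ResolutionOfSingularities.ResolutionOfSingularities.Theorems.WeightedInvariantLexMaxOrderDropFace
import Summits.ResolutionOfSingularities.ResolutionOfSingularities.Theorems.WeightedInvariantHypersurfaceLocalGameEFTDimTwoFaceCone
import Summits.ResolutionOfSingularities.ResolutionOfSingularities.Theorems.WeightedInvariantContactCylinderSuccessorSplit
import HarnessLib

/-!
# The P3a cylinder move is TIE-FREE ⇒ the order drops at every successor over the special point (ORDER (o36))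

Topic: `Summits/ResolutionOfSingularities/ResolutionOfSingularities/Theorems`. Helper for the door item
`HypersurfaceCentreConstruction` (statement `stmt-ResolutionOfSingularities-19897`, route `WeightedInvariant`), line
`local-engine` of `res-L1-w43-plan-1`, IOTA3-DESIGN v1.3 §8.4 regime CURVE° «PROVABLE NOW: ν drops strictly at every
successor» (RULING gen 11 #2, 2026-08-27T12:09:48Z), ORDER (o36) held by res-type-092 (design memo
`plan/tools/res-type-092/o36/O36-DESIGN.md` c9cc04d440dbcb6e §7 THEOREM «P3a°-drop», type (b) half; kernel plan v2,
FILE C2b-II).  Type (a) (successors over the generic point of the centre) is res-type-005's ORDER (o36a).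

## Statement (`notMem_pow_transform_of_tieFree`; `adicOrder` form `adicOrder_transform_lt_of_tieFree`)

`S` regular local, `(y, x, z)` a regular system of parameters (`spanFinrank 𝔪 = 3`), `P = (y, x)` prime; weights
`r ≥ q ≥ 1` coprime on `(y, x)` (the transversal Abramovich–Quek–Schober datum of `f` at `S_P`), `ν ≥ 1`,
`f ∈ 𝒥_{rν}((y, x); (r, q)) ∖ 𝔪^{ν+1}`, and the position is TIE-FREE:
`f ∉ 𝒥_{(r+1)ν}((x, y - λ̃x^r, z); (q, r+1, 1))` for every `λ̃ ∈ S`, and, when `q = r`, also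
`f ∉ 𝒥_{2ν}((y, x, z); (1, 2, 1))`.  Then at every prime `𝔫` of `B = S[t⁻¹, 𝒥ₙ tⁿ]` with `t⁻¹, z ∈ 𝔫` (a successor
OVER THE SPECIAL POINT) and off the vertex, every saturated factorisation `f = (t⁻¹)ᵃ g`, `t⁻¹ ∤ g`, has
`g/1 ∉ 𝔪_{B_𝔫}^ν`, i.e. `adicOrder (g/1) < ν`.

## Proof

`g = G`, the transform with special-fibre face form `Φ ≠ 0` (`…P3aSpecialFibreFace`); `𝔫̄₀ = ρ₀(𝔫)` is a prime of
`κ[X₀, X₁]` off the vertex.  If `Φ ∉ 𝔫̄₀`, `G` is a unit.  Else write `Φ` in lex-face form (`…P3aFaceForm`): for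
`q < r` the vertex coefficient `c₀` is a unit ((L1)); a NON-DEGENERATE face has order `< ν` at `𝔫̄₀` by res-type-098's
`LexMaxOrderDrop.algebraMap_lexFace_notMem_pow` (and the order only drops along `B_𝔫 ↠ κ[X₀,X₁]_{𝔫̄₀}`); a DEGENERATE
face (`deg P = 0`, or `P = c (s - l)^ν` forcing `q = 1`) puts `𝔫` on the tie curve `Y = 0` / `Y = λ̃X^r`, where Lemma B
(`…P3aTieFreeDegenerate`) converts tie-freeness into the drop.  For `q = r (= 1)` the face is a binary form; on the chart
`Xᵢ ∉ 𝔫̄₀` res-type-078's K4 core `LocalGameEFTFace.algebraMap_face_notMem_pow_of_notMem` gives the drop unless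
`Φ = c (X_j - l Xᵢ)^ν`, which is one of the tie curves `Y = λ̃X`, `Y = 0`, `X = 0`.

[OURS · L1 W4.3] Replaces the role of NO printed item; NOT a statement of the manuscript under review
[claim: Hironaka2017, status: under-review].  AI work, weaker than expert review.  Def-free.

## References

* D. Abramovich, M. H. Quek, B. Schober, arXiv:2507.01232 (v3, 2026), Thm 1.3 (3), Cor. 3.6, §5.
  [AbramovichQuekSchober2025]
* J. Włodarczyk, *Functorial resolution by torus actions*, arXiv:2203.03090, §2.3.9, §3.3. [Wlodarczyk2022]
-/

noncomputable section

open IsLocalRing Literature.AlgebraicGeometry.Resolution Polynomial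
open Summit.ResolutionOfSingularities.ResolutionOfSingularities.Cruxes.HypersurfaceCentreConstruction.LocalEngine

set_option linter.dupNamespace false -- mandated namespace of this single-conjunct summit

namespace Summit.ResolutionOfSingularities.ResolutionOfSingularities.Theorems

namespace LocalGameEFTCylinder

variable {S : Type} [CommRing S] [IsRegularLocalRing S] {y x z : S} {r q : ℕ}

/-! ### The lex-face sum over `range (deg P + 1)` vs `range (ν + 1)` -/

/-- Extending the lex-face sum to `range (ν + 1)` (coefficients beyond `deg P` vanish; `q ≥ 1`). [folklore] -/
theorem lexFace_sum_range_eq {κ : Type} [CommRing κ] (i j : Fin 2) (r q : ℕ) {ν : ℕ} {P : κ[X]}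
    (hdeg : P.natDegree ≤ ν) :
    ∑ k ∈ Finset.range (P.natDegree + 1),
        MvPolynomial.C (P.coeff k) * MvPolynomial.X i ^ (ν - q * k) * MvPolynomial.X j ^ (r * k) =
      ∑ k ∈ Finset.range (ν + 1),
        MvPolynomial.C (P.coeff k) * MvPolynomial.X i ^ (ν - q * k) * MvPolynomial.X j ^ (r * k) := by
  refine Finset.sum_subset (Finset.range_mono (Nat.succ_le_succ hdeg)) fun k hk hk' => ?_
  rw [Polynomial.coeff_eq_zero_of_natDegree_lt (by have := Finset.mem_range.not.mp hk'; omega), map_zero,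
    zero_mul, zero_mul]

/-- The reflected binary face: `Σ_k C(P_k) X₀^{ν-k} X₁^k = Σ_k C((reflect ν P)_k) X₁^{ν-k} X₀^k`. [folklore] -/
theorem binaryFace_sum_reflect {κ : Type} [CommRing κ] {ν : ℕ} (P : κ[X]) :
    ∑ k ∈ Finset.range (ν + 1),
        MvPolynomial.C (P.coeff k) * MvPolynomial.X 0 ^ (ν - k) * MvPolynomial.X 1 ^ k =
      ∑ k ∈ Finset.range (ν + 1), MvPolynomial.C ((Polynomial.reflect ν P).coeff k) *
        (MvPolynomial.X 1 : MvPolynomial (Fin 2) κ) ^ (ν - k) * MvPolynomial.X 0 ^ k := by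
  rw [← Finset.sum_range_reflect _ (ν + 1)]
  refine Finset.sum_congr rfl fun k hk => ?_
  have hk' : k ≤ ν := Nat.lt_succ_iff.mp (Finset.mem_range.mp hk)
  rw [Polynomial.coeff_reflect, Polynomial.revAt_le hk', Nat.add_sub_cancel, Nat.sub_sub_self hk']
  ring

/-! ### The main theorem: type (b) successors of a tie-free P3a position -/

/-- **ORDER (o36), type (b): a TIE-FREE P3a cylinder move drops the order at every successor over the special
point.**  See the module docstring for the hypotheses; conclusion `g/1 ∉ 𝔪_{B_𝔫}^ν` for every saturated factorisation
`f = (t⁻¹)ᵃ g` at every prime `𝔫 ∋ t⁻¹, z` of `B = S[t⁻¹, 𝒥ₙ((y,x);(r,q)) tⁿ]` off the vertex.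
[cite: AbramovichQuekSchober2025, Thm 1.3 (3), §5] -/
theorem notMem_pow_transform_of_tieFree (hyxz : Ideal.span (Set.range ![y, x, z]) = maximalIdeal S)
    (hd : (maximalIdeal S).spanFinrank = 3) [hP : (Ideal.span (Set.range ![y, x])).IsPrime]
    (hq : 0 < q) (hqr : q ≤ r) (hcop : Nat.Coprime r q) {ν : ℕ} (hν : 1 ≤ ν) {f : S}
    (hfν : f ∉ maximalIdeal S ^ (ν + 1)) (hadm : f ∈ weightedMonomialIdeal ![y, x] ![r, q] (r * ν))
    (htie : ∀ lam : S, f ∉ weightedMonomialIdeal ![x, y - lam * x ^ r, z] ![q, r + 1, 1] ((r + 1) * ν))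
    (htie' : q = r → f ∉ weightedMonomialIdeal ![y, x, z] ![1, 2, 1] (2 * ν))
    (𝔫 : Ideal (extReesAlgebra (weightedMonomialIdeal ![y, x] ![r, q]))) [𝔫.IsPrime]
    (hT : extReesAlgebra.tInv (weightedMonomialIdeal ![y, x] ![r, q]) ∈ 𝔫)
    (hz : algebraMap S (extReesAlgebra (weightedMonomialIdeal ![y, x] ![r, q])) z ∈ 𝔫)
    (hV : ¬ extReesAlgebra.vertexIdeal (weightedMonomialIdeal ![y, x] ![r, q]) ≤ 𝔫)
    {a : ℕ} {g : extReesAlgebra (weightedMonomialIdeal ![y, x] ![r, q])}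
    (hfg : algebraMap S _ f = extReesAlgebra.tInv (weightedMonomialIdeal ![y, x] ![r, q]) ^ a * g)
    (hndvd : ¬ extReesAlgebra.tInv (weightedMonomialIdeal ![y, x] ![r, q]) ∣ g) :
    algebraMap _ (Localization.AtPrime 𝔫) g ∉ maximalIdeal (Localization.AtPrime 𝔫) ^ ν := by
  classical
  haveI := isDomain_of_isRegularLocalRing S
  have hr : 0 < r := lt_of_lt_of_le hq hqr
  have hw : ∀ i, 0 < (![r, q] : Fin 2 → ℕ) i := by
    intro i; fin_cases i
    · exact hr
    · exact hq
  have hzP : z ∉ Ideal.span (Set.range ![y, x]) := notMem_span_pair hyxz hd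
  -- the two charts
  obtain ⟨ρ, -, hρker, -, hρC, -⟩ := LocalGameEFTPointMove.exists_rhoPartial ![y, x] ![r, q] hw
    (mem_maximalIdeal_pair hyxz) (linearIndependent_toCotangent_pair hyxz hd)
  obtain ⟨ρ₀, hρ₀s, hρ₀ker, hX, hC, hT0⟩ := exists_rhoZero hyxz hd ![r, q] hw
  -- the transform and its face
  obtain ⟨l, hl, hfl⟩ := exists_finsupp_of_mem_weightedMonomialIdeal ![y, x] ![r, q] hadm
  obtain ⟨G, hG, hρG⟩ := exists_transform_of_finsupp ![y, x] ![r, q] (residue S) ρ₀ hX hC hT0 l hl hfl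
  have hres : ∀ a : S, residue S a = 0 → a ∈ maximalIdeal S := fun a ha => (residue_eq_zero_iff _).mp ha
  have hΦne := face_ne_zero hyxz hr hqr hres l hl hfl hfν
  have hndG : ¬ extReesAlgebra.tInv (weightedMonomialIdeal ![y, x] ![r, q]) ∣ G :=
    not_dvd_of_map_ne_zero _ _ ρ₀ hT0 (by rw [hρG]; exact hΦne)
  obtain ⟨-, hgG⟩ := transform_unique₀ ![y, x] ![r, q] hG hndG hfg hndvd
  rw [hgG]
  -- the prime `𝔫̄₀` of `κ[X₀, X₁]`
  have hker𝔫 := ker_le_of_eq_span_pair ρ₀ hρ₀ker 𝔫 hT hz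
  haveI := map_isPrime_of_ker_le ρ₀ hρ₀s 𝔫 hker𝔫
  have h𝔫 : 𝔫 = (𝔫.map ρ₀).comap ρ₀ := (comap_map_eq_of_ker_le ρ₀ hρ₀s 𝔫 hker𝔫).symm
  have hvert := not_span_pair_X_le_map hρ₀s hX 𝔫 hker𝔫 hV
  have hmem_iff : ∀ b, b ∈ 𝔫 ↔ ρ₀ b ∈ 𝔫.map ρ₀ := fun b => by
    constructor
    · exact Ideal.mem_map_of_mem ρ₀
    · intro hb; rw [h𝔫]; exact Ideal.mem_comap.mpr hb
  by_cases hΦ𝔫 : ρ₀ G ∈ 𝔫.map ρ₀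
  swap
  · exact not_mem_pow_of_map_notMem ρ₀ 𝔫 _ h𝔫 hΦ𝔫 hν
  -- the lex-face polynomial
  have hfilt : l.support.filter (fun α => ∑ i, ![r, q] i * α i = r * ν) =
      l.support.filter (fun α => r * α 0 + q * α 1 = r * ν) := by
    ext α
    simp only [Finset.mem_filter, Fin.sum_univ_two, Matrix.cons_val_zero, Matrix.cons_val_one]
  obtain ⟨P, hdegP, hPcoeff, hΦP⟩ := exists_lexFacePolynomial hr hq hcop ν l.support (fun α => residue S (l α))
  have hΦeq : ρ₀ G = ∑ j ∈ Finset.range (P.natDegree + 1),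
      MvPolynomial.C (P.coeff j) * MvPolynomial.X 0 ^ (ν - q * j) * MvPolynomial.X 1 ^ (r * j) := by
    rw [hρG, hfilt, hΦP]
  have hdegq : q * P.natDegree ≤ ν := (Nat.mul_le_mul_left q hdegP).trans (Nat.mul_div_le ν q)
  -- membership transfer tools
  have hXmem : ∀ i, MvPolynomial.X i ∈ 𝔫.map ρ₀ → LocalGameEFTPointMove.uT ![y, x] ![r, q] i ∈ 𝔫 := fun i hi =>
    (hmem_iff _).mpr (by rw [hX]; exact hi)
  have hXnot : ∀ i, MvPolynomial.X i ∉ 𝔫.map ρ₀ → LocalGameEFTPointMove.uT ![y, x] ![r, q] i ∉ 𝔫 := fun i hi h =>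
    hi (by rw [← hX]; exact (hmem_iff _).mp h)
  rcases lt_or_eq_of_le hqr with hlt | heq
  · -- CASE `q < r`: the vertex coefficient is a unit
    have hv0 : (![ν - q * 0, r * 0] : Fin 2 → ℕ) = ![ν, 0] := by simp
    have hP0 : P.coeff 0 ≠ 0 := by
      rw [hPcoeff, if_pos (Nat.succ_pos _), hv0]
      have hne := residue_vertex_ne_zero hyxz hlt hres l hl hfl hfν
      rw [if_pos (Finsupp.mem_support_iff.mpr fun h0 => hne (by rw [h0, map_zero]))]
      exact hne
    by_cases hdeg0 : P.natDegree = 0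
    · -- degenerate face `c₀ X₀^ν`: the successor lies on `Y = 0`
      have hΦ0 : ρ₀ G = MvPolynomial.C (P.coeff 0) * MvPolynomial.X 0 ^ ν := by
        rw [hΦeq, lexFace_sum_eq_of_natDegree_eq_zero 0 1 r q ν hdeg0]
      have hX0 : (MvPolynomial.X 0 : MvPolynomial (Fin 2) (ResidueField S)) ∈ 𝔫.map ρ₀ :=
        mem_of_C_mul_pow_mem hP0 (by rw [← hΦ0]; exact hΦ𝔫)
      have hX1 : (MvPolynomial.X 1 : MvPolynomial (Fin 2) (ResidueField S)) ∉ 𝔫.map ρ₀ :=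
        X_notMem_of_sub_mem (μ := (0 : ResidueField S)) Fin.zero_ne_one hr
          (by rw [map_zero, zero_mul, sub_zero]; exact hX0) hvert
      exact notMem_pow_of_Y_mem hyxz hzP hρker hρC hρ₀s hρ₀ker hX 𝔫 hT hz hG hq (hXmem 0 hX0) (hXnot 1 hX1)
        (by have h := htie 0; rwa [zero_mul, sub_zero] at h)
    by_cases hpow : ∃ cc lb : ResidueField S, P = C cc * (X - C lb) ^ ν
    · -- degenerate face `c (X₁^r - l X₀)^ν`: `q = 1` and the successor lies on `Y = l⁻¹ X^r`
      obtain ⟨cc, lb, hcl⟩ := hpow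
      have hcc0 : cc ≠ 0 := by
        intro h0; apply hP0; rw [hcl, h0, map_zero, zero_mul, Polynomial.coeff_zero]
      have hdegν : P.natDegree = ν := by
        rw [hcl, Polynomial.natDegree_C_mul hcc0, Polynomial.natDegree_pow, Polynomial.natDegree_X_sub_C, mul_one]
      have hq1 : q = 1 := by
        have h1 : q * ν ≤ ν := by
          calc q * ν = q * P.natDegree := by rw [hdegν]
            _ ≤ ν := hdegq
        have h2 : 1 * ν ≤ q * ν := Nat.mul_le_mul_right ν hq
        by_contra hne
        have h3 : 2 * ν ≤ q * ν := Nat.mul_le_mul_right ν (by omega)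
        omega
      have hlb0 : lb ≠ 0 := by
        intro h0
        apply hP0
        rw [hcl, h0, map_zero, sub_zero, Polynomial.coeff_C_mul, Polynomial.coeff_X_pow, if_neg (by omega), mul_zero]
      -- `Φ = C(cc (-lb)^ν) · (X₀ - lb⁻¹ X₁^r)^ν`
      have hΦ1 : ρ₀ G = MvPolynomial.C (cc * (-lb) ^ ν) *
          (MvPolynomial.X 0 - MvPolynomial.C lb⁻¹ * MvPolynomial.X 1 ^ r) ^ ν := by
        rw [hΦeq, hdegν]
        have h := lexFace_sum_eq_C_mul_pow (κ := ResidueField S) 0 1 r ν hcl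
        simp_rw [hq1, one_mul] at h ⊢
        rw [h, X_pow_sub_C_mul_X_eq 0 1 r hlb0, mul_pow, ← mul_assoc, ← map_pow, ← map_mul]
      have hunit : cc * (-lb) ^ ν ≠ 0 := mul_ne_zero hcc0 (pow_ne_zero _ (neg_ne_zero.mpr hlb0))
      have hLmem : MvPolynomial.X 0 - MvPolynomial.C lb⁻¹ * MvPolynomial.X 1 ^ r ∈ 𝔫.map ρ₀ :=
        mem_of_C_mul_pow_mem hunit (by rw [← hΦ1]; exact hΦ𝔫)
      have hX1 : (MvPolynomial.X 1 : MvPolynomial (Fin 2) (ResidueField S)) ∉ 𝔫.map ρ₀ :=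
        X_notMem_of_sub_mem Fin.zero_ne_one hr hLmem hvert
      obtain ⟨lam, hlam⟩ := IsLocalRing.residue_surjective (R := S) lb⁻¹
      have hWmem : LocalGameEFTPointMove.uT ![y, x] ![r, q] 0 -
          algebraMap S _ lam * LocalGameEFTPointMove.uT ![y, x] ![r, q] 1 ^ r ∈ 𝔫 := by
        refine (hmem_iff _).mpr ?_
        rw [map_sub, map_mul, map_pow, hX, hX, hC, hlam]
        exact hLmem
      exact notMem_pow_of_steep_mem hyxz hzP hρker hρC hρ₀s hρ₀ker hX hC 𝔫 hT hz hG hq1 hr lam hWmem (hXnot 1 hX1)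
        (htie lam)
    · -- non-degenerate face: res-type-098's face bound, transferred along `B_𝔫 → κ[X₀,X₁]_{𝔫̄₀}`
      exact not_mem_pow_of_map ρ₀ 𝔫 _ h𝔫
        (LexMaxOrderDrop.algebraMap_lexFace_notMem_pow hr hq hcop hν hdegq hP0 (Nat.pos_of_ne_zero hdeg0) hpow hΦeq
          (𝔫.map ρ₀) hvert)
  · -- CASE `q = r` (`= 1` by coprimality): a binary form of degree `ν`
    have hr1 : r = 1 := by have h := hcop; rw [← heq] at h; rw [← heq]; exact (Nat.coprime_self _).mp h
    have hq1 : q = 1 := heq.trans hr1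
    have htie1 := htie' heq
    subst hq1 hr1
    have hdegν : P.natDegree ≤ ν := by simpa using hdegP
    -- the binary face on `range (ν + 1)` (res-type-078's K4 shape, chart `X₀ ∉ 𝔫̄₀`)
    have hΦν : ρ₀ G = ∑ k ∈ Finset.range (ν + 1),
        MvPolynomial.C (P.coeff k) * MvPolynomial.X 0 ^ (1 * (ν - k)) * MvPolynomial.X 1 ^ k := by
      rw [hΦeq, lexFace_sum_range_eq 0 1 1 1 hdegν]
      simp only [one_mul]
    by_cases hX0 : (MvPolynomial.X 0 : MvPolynomial (Fin 2) (ResidueField S)) ∈ 𝔫.map ρ₀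
    · -- chart `X₁ ∉ 𝔫̄₀`: reflect the binary form
      have hX1 : (MvPolynomial.X 1 : MvPolynomial (Fin 2) (ResidueField S)) ∉ 𝔫.map ρ₀ := fun h1 => hvert (by
        rw [Ideal.span_le, Set.insert_subset_iff, Set.singleton_subset_iff]; exact ⟨hX0, h1⟩)
      have hΦr : ρ₀ G = ∑ k ∈ Finset.range (ν + 1), MvPolynomial.C ((Polynomial.reflect ν P).coeff k) *
          MvPolynomial.X 1 ^ (1 * (ν - k)) * MvPolynomial.X 0 ^ k := by
        rw [hΦν]
        simp only [one_mul]
        exact binaryFace_sum_reflect P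
      have hdegr : (Polynomial.reflect ν P).natDegree ≤ ν :=
        Polynomial.natDegree_reflect_le.trans (max_le le_rfl hdegν)
      by_cases hpow : ∃ cc lb : ResidueField S, Polynomial.reflect ν P = C cc * (X - C lb) ^ ν
      · -- `Φ = c (X₀ - l X₁)^ν`: the successor lies on `Y = l X`
        obtain ⟨cc, lb, hcl⟩ := hpow
        have hΦ1 : ρ₀ G = MvPolynomial.C cc * (MvPolynomial.X 0 - MvPolynomial.C lb * MvPolynomial.X 1 ^ 1) ^ ν := by
          rw [hΦr]
          have h := lexFace_sum_eq_C_mul_pow (κ := ResidueField S) 1 0 1 ν hcl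
          simp only [one_mul, pow_one] at h ⊢
          exact h
        have hcc0 : cc ≠ 0 := by
          intro h0; apply hΦne; rw [← hρG, hΦ1, h0, map_zero, zero_mul]
        have hLmem : MvPolynomial.X 0 - MvPolynomial.C lb * MvPolynomial.X 1 ^ 1 ∈ 𝔫.map ρ₀ :=
          mem_of_C_mul_pow_mem hcc0 (by rw [← hΦ1]; exact hΦ𝔫)
        obtain ⟨lam, hlam⟩ := IsLocalRing.residue_surjective (R := S) lb
        have hWmem : LocalGameEFTPointMove.uT ![y, x] ![1, 1] 0 -
            algebraMap S _ lam * LocalGameEFTPointMove.uT ![y, x] ![1, 1] 1 ^ 1 ∈ 𝔫 := by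
          refine (hmem_iff _).mpr ?_
          rw [map_sub, map_mul, map_pow, hX, hX, hC, hlam]
          exact hLmem
        exact notMem_pow_of_steep_mem hyxz hzP hρker hρC hρ₀s hρ₀ker hX hC 𝔫 hT hz hG rfl one_pos lam hWmem
          (hXnot 1 hX1) (htie lam)
      · exact not_mem_pow_of_map ρ₀ 𝔫 _ h𝔫
          (LocalGameEFTFace.algebraMap_face_notMem_pow_of_notMem (Fin.zero_ne_one (n := 0)).symm hν hdegr hpow hΦr
            (𝔫.map ρ₀) hX1)
    · -- chart `X₀ ∉ 𝔫̄₀`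
      by_cases hpow : ∃ cc lb : ResidueField S, P = C cc * (X - C lb) ^ ν
      · obtain ⟨cc, lb, hcl⟩ := hpow
        have hΦ1 : ρ₀ G = MvPolynomial.C cc * (MvPolynomial.X 1 ^ 1 - MvPolynomial.C lb * MvPolynomial.X 0) ^ ν := by
          rw [hΦν]
          have h := lexFace_sum_eq_C_mul_pow (κ := ResidueField S) 0 1 1 ν hcl
          simp only [one_mul] at h ⊢
          exact h
        have hcc0 : cc ≠ 0 := by
          intro h0; apply hΦne; rw [← hρG, hΦ1, h0, map_zero, zero_mul]
        by_cases hlb0 : lb = 0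
        · -- `Φ = c X₁^ν`: the successor lies on `X = 0`
          subst hlb0
          have hmem1 : MvPolynomial.C cc * (MvPolynomial.X 1 ^ 1) ^ ν ∈ 𝔫.map ρ₀ := by
            have h := hΦ𝔫
            rw [hΦ1, map_zero, zero_mul, sub_zero] at h
            exact h
          have hX1 : (MvPolynomial.X 1 : MvPolynomial (Fin 2) (ResidueField S)) ∈ 𝔫.map ρ₀ := by
            have h := mem_of_C_mul_pow_mem hcc0 hmem1
            rwa [pow_one] at h
          exact notMem_pow_of_X_mem hyxz hzP hρker hρC hρ₀s hρ₀ker hX 𝔫 hT hz hG rfl rfl (hXmem 1 hX1) (hXnot 0 hX0)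
            htie1
        · -- `Φ = c' (X₀ - l⁻¹ X₁)^ν`: the successor lies on `Y = l⁻¹ X`
          have hΦ2 : ρ₀ G = MvPolynomial.C (cc * (-lb) ^ ν) *
              (MvPolynomial.X 0 - MvPolynomial.C lb⁻¹ * MvPolynomial.X 1 ^ 1) ^ ν := by
            rw [hΦ1, X_pow_sub_C_mul_X_eq 0 1 1 hlb0, mul_pow, ← mul_assoc, ← map_pow, ← map_mul]
          have hunit : cc * (-lb) ^ ν ≠ 0 := mul_ne_zero hcc0 (pow_ne_zero _ (neg_ne_zero.mpr hlb0))
          have hLmem : MvPolynomial.X 0 - MvPolynomial.C lb⁻¹ * MvPolynomial.X 1 ^ 1 ∈ 𝔫.map ρ₀ :=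
            mem_of_C_mul_pow_mem hunit (by rw [← hΦ2]; exact hΦ𝔫)
          have hX1 : (MvPolynomial.X 1 : MvPolynomial (Fin 2) (ResidueField S)) ∉ 𝔫.map ρ₀ :=
            X_notMem_of_sub_mem Fin.zero_ne_one one_pos hLmem hvert
          obtain ⟨lam, hlam⟩ := IsLocalRing.residue_surjective (R := S) lb⁻¹
          have hWmem : LocalGameEFTPointMove.uT ![y, x] ![1, 1] 0 -
              algebraMap S _ lam * LocalGameEFTPointMove.uT ![y, x] ![1, 1] 1 ^ 1 ∈ 𝔫 := by
            refine (hmem_iff _).mpr ?_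
            rw [map_sub, map_mul, map_pow, hX, hX, hC, hlam]
            exact hLmem
          exact notMem_pow_of_steep_mem hyxz hzP hρker hρC hρ₀s hρ₀ker hX hC 𝔫 hT hz hG rfl one_pos lam hWmem
            (hXnot 1 hX1) (htie lam)
      · exact not_mem_pow_of_map ρ₀ 𝔫 _ h𝔫
          (LocalGameEFTFace.algebraMap_face_notMem_pow_of_notMem (Fin.zero_ne_one (n := 0)) hν hdegν hpow hΦν
            (𝔫.map ρ₀) hX0)

/-- **`adicOrder` form** (the (drop) currency of the clauses): under the hypotheses of
`notMem_pow_transform_of_tieFree`, `adicOrder (g/1) < ν`. [cite: AbramovichQuekSchober2025, Thm 1.3 (3)] -/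
theorem adicOrder_transform_lt_of_tieFree (hyxz : Ideal.span (Set.range ![y, x, z]) = maximalIdeal S)
    (hd : (maximalIdeal S).spanFinrank = 3) [hP : (Ideal.span (Set.range ![y, x])).IsPrime]
    (hq : 0 < q) (hqr : q ≤ r) (hcop : Nat.Coprime r q) {ν : ℕ} (hν : 1 ≤ ν) {f : S}
    (hfν : f ∉ maximalIdeal S ^ (ν + 1)) (hadm : f ∈ weightedMonomialIdeal ![y, x] ![r, q] (r * ν))
    (htie : ∀ lam : S, f ∉ weightedMonomialIdeal ![x, y - lam * x ^ r, z] ![q, r + 1, 1] ((r + 1) * ν))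
    (htie' : q = r → f ∉ weightedMonomialIdeal ![y, x, z] ![1, 2, 1] (2 * ν))
    (𝔫 : Ideal (extReesAlgebra (weightedMonomialIdeal ![y, x] ![r, q]))) [𝔫.IsPrime]
    (hT : extReesAlgebra.tInv (weightedMonomialIdeal ![y, x] ![r, q]) ∈ 𝔫)
    (hz : algebraMap S (extReesAlgebra (weightedMonomialIdeal ![y, x] ![r, q])) z ∈ 𝔫)
    (hV : ¬ extReesAlgebra.vertexIdeal (weightedMonomialIdeal ![y, x] ![r, q]) ≤ 𝔫)
    {a : ℕ} {g : extReesAlgebra (weightedMonomialIdeal ![y, x] ![r, q])}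
    (hfg : algebraMap S _ f = extReesAlgebra.tInv (weightedMonomialIdeal ![y, x] ![r, q]) ^ a * g)
    (hndvd : ¬ extReesAlgebra.tInv (weightedMonomialIdeal ![y, x] ![r, q]) ∣ g) :
    adicOrder (algebraMap _ (Localization.AtPrime 𝔫) g) < (ν : ℕ∞) :=
  adicOrder_lt_of_not_mem_pow hν
    (notMem_pow_transform_of_tieFree hyxz hd hq hqr hcop hν hfν hadm htie htie' 𝔫 hT hz hV hfg hndvd)


/-- **Type (b) in the binder shape `hB` of res-type-005's glue `ContactCylinder.curve_drop_of_typeA_typeB`** (letter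
`ι = iotaOrd`, threshold `ι₀ = ν`, carrier `cobordantAlgebra' ![y, x] ![r, q]`): over the special point (`𝔪 ≤ 𝔫 ∩ S`)
every saturated transform has `iotaOrd (g/1) < ν`.  With 005's type (a) (`…ContactCylinderGenericSuccessor`) this is
the CURVE° (drop) of IOTA3-DESIGN v1.3 §8.4 for the letter `ν`. [cite: AbramovichQuekSchober2025, Thm 1.3 (3)] -/
theorem iotaOrd_transform_lt_of_tieFree_typeB (hyxz : Ideal.span (Set.range ![y, x, z]) = maximalIdeal S)
    (hd : (maximalIdeal S).spanFinrank = 3) [hP : (Ideal.span (Set.range ![y, x])).IsPrime]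
    (hq : 0 < q) (hqr : q ≤ r) (hcop : Nat.Coprime r q) {ν : ℕ} (hν : 1 ≤ ν) {f : S}
    (hfν : f ∉ maximalIdeal S ^ (ν + 1)) (hadm : f ∈ weightedMonomialIdeal ![y, x] ![r, q] (r * ν))
    (htie : ∀ lam : S, f ∉ weightedMonomialIdeal ![x, y - lam * x ^ r, z] ![q, r + 1, 1] ((r + 1) * ν))
    (htie' : q = r → f ∉ weightedMonomialIdeal ![y, x, z] ![1, 2, 1] (2 * ν)) (P : Ideal S) :
    ∀ (𝔫 : Ideal (cobordantAlgebra' ![y, x] ![r, q])) [𝔫.IsPrime], cobordantT' ![y, x] ![r, q] ∈ 𝔫 →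
      P.map (algebraMap S (cobordantAlgebra' ![y, x] ![r, q])) ≤ 𝔫 →
      ¬ extReesAlgebra.vertexIdeal (weightedMonomialIdeal ![y, x] ![r, q]) ≤ 𝔫 →
      maximalIdeal S ≤ 𝔫.comap (algebraMap S (cobordantAlgebra' ![y, x] ![r, q])) →
      ∀ (a : ℕ) (g : cobordantAlgebra' ![y, x] ![r, q]),
        algebraMap S (cobordantAlgebra' ![y, x] ![r, q]) f = cobordantT' ![y, x] ![r, q] ^ a * g →
        ¬ cobordantT' ![y, x] ![r, q] ∣ g →
        algebraMap (cobordantAlgebra' ![y, x] ![r, q]) (Localization.AtPrime 𝔫) g ∈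
          maximalIdeal (Localization.AtPrime 𝔫) ^ 2 →
        iotaOrd (Localization.AtPrime 𝔫) (algebraMap (cobordantAlgebra' ![y, x] ![r, q]) (Localization.AtPrime 𝔫) g) <
          (ν : Ordinal.{0}) := by
  intro 𝔫 _ hT _ hV hM a g hfg hndvd _
  have hz : algebraMap S (cobordantAlgebra' ![y, x] ![r, q]) z ∈ 𝔫 :=
    hM (hyxz ▸ Ideal.subset_span ⟨2, rfl⟩)
  exact LocalGameEFTFace.iotaOrd_lt_of_notMem_pow
    (notMem_pow_transform_of_tieFree hyxz hd hq hqr hcop hν hfν hadm htie htie' 𝔫 hT hz hV hfg hndvd)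

end LocalGameEFTCylinder

end Summit.ResolutionOfSingularities.ResolutionOfSingularities.Theorems

end
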